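import Mathlib
import HarnessLib
import Summits.RiemannHypothesis.RiemannHypothesis.Theorems.IntegerScrewCSharpUpper

/-!
# Route `IntegerScrew` — THEOREM C♯ FROM EVERY STATE (CONTINUUM-LIMIT 16.0, «more generally»), in the kernel:
# `K(τ,ρ_x)Π_{p∣x}(1−e^{−τθ_p})·e^{−16τ/log M} ≤ P_x(X_{τ/log M} = 1) ≤ K(τ,ρ_x)Π_{p∣x}[(1−e^{−τθ_p})p/(p−1)]·e^{65τ/log M}`

THEOREM C♯ (PIVOT-LAW 13.44 / CONTINUUM-LIMIT 16.0) is stated from the start state `1` AND «more generally, for every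
x ≤ M»: `h̃(τ;x)e^{−ε⁻τ} ≤ P_x(X_{τ/L} = 1) ≤ h′(τ;x)e^{ε⁺τ}` with `h̃(τ;x) = K(τ,ρ_x)Π_{p∣x}(1 − e^{−τθ_p})` (LEMMA G's
continuum return function read on the state) and `h′ = h̃·W`, `W(x) = Π_{p∣x}p/(p−1)` — the form THEOREM C′, LEMMA J,
the room law and THEOREM C♭'s two-point sums use.  The transfer argument is the same from any start state: the
comparison function is space-time (almost) harmonic at EVERY state (`sixteen_five_lower` / `sixteen_five_upper` of
`IntegerScrewCSharpLower/Upper`), and gen12's Markov transfer lemma (`markovTransfer_le/_ge`) is stated for an arbitrary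
start `x₀`.  This file runs gen12's `returnProb_le/ge_of_generator_le/ge` skeleton with `x₀` in place of `1`
(the limit `η → 0⁺` on the comparison side is now the continuity of `u ↦ h̃(u;x₀)` at `τ > 0` instead of `h̃(·;1) = g`).

RESULTS (`M ≥ 2`, `τ > 0`, `x₀ : St M`): `returnProbFrom_ge_csharp` : `e^{−(16/log M)τ}·h̃(τ;x₀) ≤ (e^{τ·walkGen M})_{x₀,1}`;
`returnProbFrom_le_csharp` : `(e^{τ·walkGen M})_{x₀,1} ≤ e^{(65/log M)τ}·h′(τ;x₀)`.  Unconditional; RH-free; nothing here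
bears on the truth of RH.  References: CONTINUUM-LIMIT §16.0, §9 (LEMMA G), §13 (room law); PIVOT-LAW 13.44, 13.53;
M. Suzuki, J. Lond. Math. Soc. (2) 108 (2023) 1448–1487 [Suzuki2023].
-/

noncomputable section

-- D-0017: `Summit.<S>.<S>.…` is the designed namespace of a single-problem summit.
set_option linter.dupNamespace false

namespace Summit.RiemannHypothesis.RiemannHypothesis.Theorems.IntegerScrew

open Real NormedSpace Finset Set Filter Topology ArithmeticFunction

/-- The `η → 0⁺` limit on the walk side, from any start `x₀`: `Σ_y (e^{τQ})_{x₀y}·f(η;y) → (e^{τQ})_{x₀,1}` when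
`f(η;y) → 𝟙[y = 1]`. -/
theorem tendsto_sum_exp_mul_of_tendsto_indicator {M : ℕ} (hM : 1 ≤ M) (τ : ℝ) (x₀ : St M) (f : ℝ → ℕ → ℝ)
    (hf : ∀ y : St M, Tendsto (fun η => f η y) (𝓝[>] 0) (𝓝 (if (y : ℕ) = 1 then 1 else 0))) :
    Tendsto (fun η => ∑ y : St M, (exp (τ • walkGen M)) x₀ y * f η y) (𝓝[>] 0)
      (𝓝 ((exp (τ • walkGen M)) x₀ (stOne hM))) := by
  have h1 : Tendsto (fun η => ∑ y : St M, (exp (τ • walkGen M)) x₀ y * f η y)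
      (𝓝[>] 0) (𝓝 (∑ y : St M, (exp (τ • walkGen M)) x₀ y * (if (y : ℕ) = 1 then 1 else 0))) :=
    tendsto_finsetSum _ fun y _ => (hf y).const_mul _
  have h2 : (∑ y : St M, (exp (τ • walkGen M)) x₀ y * (if (y : ℕ) = 1 then (1 : ℝ) else 0)) =
      (exp (τ • walkGen M)) x₀ (stOne hM) := by
    have h3 : ∀ y : St M, ((y : ℕ) = 1) = (y = stOne hM) := by
      intro y
      apply propext
      constructor
      · intro h; exact Subtype.ext h
      · intro h; rw [h]; rfl
    simp_rw [h3, mul_ite, mul_one, mul_zero, Finset.sum_ite_eq', Finset.mem_univ, if_true]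
  rw [h2] at h1
  exact h1

/-- **Lower skeleton from any state**: the generator inequality for `h̃` with a derivative datum `D` gives
`e^{−ετ}·h̃(τ;x₀) ≤ (e^{τ·walkGen M})_{x₀,1}`. -/
theorem returnProbFrom_ge_of_generator_ge {M : ℕ} (hM : 1 ≤ M) {τ ε : ℝ} (hτ : 0 < τ) (x₀ : St M)
    (D : ℝ → ℕ → ℝ)
    (hD : ∀ u, 0 < u → ∀ x : St M, HasDerivAt (fun v => hTilde (Real.log M) v x) (D u x) u)
    (hineq : ∀ u, 0 < u → ∀ z : St M,
      -(ε * hTilde (Real.log M) u z) ≤ (∑ y : St M, walkGen M z y * hTilde (Real.log M) u y) - D u z) :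
    Real.exp (-(ε * τ)) * hTilde (Real.log M) τ x₀ ≤ (exp (τ • walkGen M)) x₀ (stOne hM) := by
  set L := Real.log M with hL
  have hstep : ∀ η : ℝ, 0 < η →
      Real.exp (-(ε * τ)) * hTilde L (τ + η) x₀ ≤
        ∑ y : St M, (exp (τ • walkGen M)) x₀ y * hTilde L η y := by
    intro η hη
    have h := markovTransfer_ge (walkGen M) (walkGen_offdiag_nonneg M) x₀
      (fun u y => hTilde L (u + η) y) (fun u y => D (u + η) y) (τ := τ) (β := ε) hτ.le
      (fun y => ?_) (fun u hu y => ?_) (fun u hu z => ?_)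
    · simpa only [zero_add] using h
    · refine continuousOn_of_forall_continuousAt fun u hu => ?_
      have hpos : 0 < u + η := by have := hu.1; linarith
      have hd := (hD (u + η) hpos y).comp u ((hasDerivAt_id' u).add_const η)
      exact hd.continuousAt
    · have hpos : 0 < u + η := by have := hu.1; linarith
      exact ((hD (u + η) hpos y).comp u ((hasDerivAt_id' u).add_const η)).congr_deriv (by ring)
    · have hpos : 0 < u + η := by have := hu.1; linarith
      exact hineq (u + η) hpos z
  have hlim_r := tendsto_sum_exp_mul_of_tendsto_indicator hM τ x₀ (fun η y => hTilde L η y)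
    (fun y => tendsto_hTilde_zero L (by have := (Finset.mem_Icc.1 y.2).1; omega))
  have hlim_l : Tendsto (fun η => Real.exp (-(ε * τ)) * hTilde L (τ + η) x₀) (𝓝[>] 0)
      (𝓝 (Real.exp (-(ε * τ)) * hTilde L τ x₀)) := by
    refine Tendsto.const_mul _ ?_
    have hc : ContinuousAt (fun v => hTilde L v x₀) τ := (hD τ hτ x₀).continuousAt
    have ht : Tendsto (fun η : ℝ => τ + η) (𝓝[>] 0) (𝓝 τ) := by
      have : Tendsto (fun η : ℝ => τ + η) (𝓝 0) (𝓝 (τ + 0)) :=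
        (continuous_const.add continuous_id).tendsto 0
      rw [add_zero] at this
      exact this.mono_left nhdsWithin_le_nhds
    exact hc.tendsto.comp ht
  refine le_of_tendsto_of_tendsto hlim_l hlim_r ?_
  filter_upwards [self_mem_nhdsWithin] with η hη
  exact hstep η hη

/-- **Upper skeleton from any state** (with `h′`): `(e^{τ·walkGen M})_{x₀,1} ≤ e^{ετ}·h′(τ;x₀)`. -/
theorem returnProbFrom_le_of_generator_le {M : ℕ} (hM : 1 ≤ M) {τ ε : ℝ} (hτ : 0 < τ) (x₀ : St M)
    (D : ℝ → ℕ → ℝ)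
    (hD : ∀ u, 0 < u → ∀ x : St M, HasDerivAt (fun v => hPrime (Real.log M) v x) (D u x) u)
    (hineq : ∀ u, 0 < u → ∀ z : St M,
      (∑ y : St M, walkGen M z y * hPrime (Real.log M) u y) - D u z ≤ ε * hPrime (Real.log M) u z) :
    (exp (τ • walkGen M)) x₀ (stOne hM) ≤ Real.exp (ε * τ) * hPrime (Real.log M) τ x₀ := by
  set L := Real.log M with hL
  have hstep : ∀ η : ℝ, 0 < η →
      ∑ y : St M, (exp (τ • walkGen M)) x₀ y * hPrime L η y ≤
        Real.exp (ε * τ) * hPrime L (τ + η) x₀ := by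
    intro η hη
    have h := markovTransfer_le (walkGen M) (walkGen_offdiag_nonneg M) x₀
      (fun u y => hPrime L (u + η) y) (fun u y => D (u + η) y) (τ := τ) (β := ε) hτ.le
      (fun y => ?_) (fun u hu y => ?_) (fun u hu z => ?_)
    · simpa only [zero_add] using h
    · refine continuousOn_of_forall_continuousAt fun u hu => ?_
      have hpos : 0 < u + η := by have := hu.1; linarith
      have hd := (hD (u + η) hpos y).comp u ((hasDerivAt_id' u).add_const η)
      exact hd.continuousAt
    · have hpos : 0 < u + η := by have := hu.1; linarith
      exact ((hD (u + η) hpos y).comp u ((hasDerivAt_id' u).add_const η)).congr_deriv (by ring)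
    · have hpos : 0 < u + η := by have := hu.1; linarith
      exact hineq (u + η) hpos z
  have hlim_l := tendsto_sum_exp_mul_of_tendsto_indicator hM τ x₀ (fun η y => hPrime L η y)
    (fun y => tendsto_hPrime_zero L (by have := (Finset.mem_Icc.1 y.2).1; omega))
  have hlim_r : Tendsto (fun η => Real.exp (ε * τ) * hPrime L (τ + η) x₀) (𝓝[>] 0)
      (𝓝 (Real.exp (ε * τ) * hPrime L τ x₀)) := by
    refine Tendsto.const_mul _ ?_
    have hc : ContinuousAt (fun v => hPrime L v x₀) τ := (hD τ hτ x₀).continuousAt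
    have ht : Tendsto (fun η : ℝ => τ + η) (𝓝[>] 0) (𝓝 τ) := by
      have : Tendsto (fun η : ℝ => τ + η) (𝓝 0) (𝓝 (τ + 0)) :=
        (continuous_const.add continuous_id).tendsto 0
      rw [add_zero] at this
      exact this.mono_left nhdsWithin_le_nhds
    exact hc.tendsto.comp ht
  refine le_of_tendsto_of_tendsto hlim_l hlim_r ?_
  filter_upwards [self_mem_nhdsWithin] with η hη
  exact hstep η hη

/-- **THEOREM C♯ from every state, lower half (kernel, unconditional).** For `M ≥ 2`, `τ > 0`, `x₀ ∈ {1,…,M}`: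
`e^{−(16/log M)τ}·K(τ,ρ_{x₀})·Π_{p∣x₀}(1 − e^{−τθ_p}) ≤ (e^{τ·walkGen M})_{x₀,1} = P_{x₀}(X_{τ/log M} = 1)`. -/
theorem returnProbFrom_ge_csharp {M : ℕ} (hM : 2 ≤ M) {τ : ℝ} (hτ : 0 < τ) (x₀ : St M) :
    Real.exp (-(16 / Real.log M * τ)) * hTilde (Real.log M) τ x₀ ≤
      (exp (τ • walkGen M)) x₀ (stOne (by omega : 1 ≤ M)) := by
  refine returnProbFrom_ge_of_generator_ge (by omega) hτ x₀ (fun u x => hTildeDeriv (Real.log M) u x)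
    (fun _ hu x => hasDerivAt_hTilde (Real.log M) hu.ne' x) fun u hu z => ?_
  rw [walkGen_sum_eq_arith M (fun y => hTilde (Real.log M) u y) z]
  exact sixteen_five_lower hM hu z.2

/-- **THEOREM C♯ from every state, upper half (kernel, unconditional).** For `M ≥ 2`, `τ > 0`, `x₀ ∈ {1,…,M}`:
`(e^{τ·walkGen M})_{x₀,1} ≤ e^{(65/log M)τ}·K(τ,ρ_{x₀})·Π_{p∣x₀}(1 − e^{−τθ_p})·W(x₀)`. -/
theorem returnProbFrom_le_csharp {M : ℕ} (hM : 2 ≤ M) {τ : ℝ} (hτ : 0 < τ) (x₀ : St M) :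
    (exp (τ • walkGen M)) x₀ (stOne (by omega : 1 ≤ M)) ≤
      Real.exp (65 / Real.log M * τ) * hPrime (Real.log M) τ x₀ := by
  refine returnProbFrom_le_of_generator_le (by omega) hτ x₀ (fun u x => hPrimeDeriv (Real.log M) u x)
    (fun _ hu x => hasDerivAt_hPrime (Real.log M) hu.ne' x) fun u hu z => ?_
  rw [walkGen_sum_eq_arith M (fun y => hPrime (Real.log M) u y) z]
  exact sixteen_five_upper hM hu z.2

end Summit.RiemannHypothesis.RiemannHypothesis.Theorems.IntegerScrew

end
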